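import Literature.Claims.NS.Nadirashvili2026
import Literature.Analysis.FluidPDE.TorusLerayHopfEpoqueRate
import HarnessLib

/-!
# Solo salvage for claim C129 `Nadirashvili2026` (cell `ns-claims`, D-0090): Step 3 `Step_LerayRate`
# (Theorem 5.6 p. 34 — Leray's rate at an «époque d'irrégularité») is TRUE, kernel

Claim skeleton: `Literature/Claims/NS/Nadirashvili2026.lean` (N. Nadirashvili, arXiv:2606.02811 v4; typist
`ns-claims-typist-7` g3). ADJUDICATED #116: first failing step `Step_subsol` (5.18) p. 36, false lemma
(`…Theorems.Nadirashvili2026.not_Step_subsol`). This file (seat `ns-claims-salvage-p3` g4) certifies that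
Step 3 — «Let 0 < t₁ < ∞ be an "époque de irrégularite" for w. Then ‖∇w‖_{L²(M)} ≥ Cν^{3/4}/(t₁ − t)^{1/4}
for t < t₁» (Theorem 5.6 p. 34, citing Leray [Le]) — holds EXACTLY as typed (squared, along the classical
representative of the `EpoqueData`): it is the tree's Leray–Hopf form of Leray's rate on `𝕋³`,
`Literature.Analysis.FluidPDE.Torus.leray_epoque_rate` (file `TorusLerayHopfEpoqueRate.lean`, this seat:
enstrophy door + gluing + Leray–Hopf restart at a.e. time + Sather–Serrin weak–strong uniqueness +
Galilean reduction of the mean; Robinson–Rodrigo–Sadowski 2016 Lemma 6.11 / Thm 6.10 / §8.1). The step was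
TABLED by salvage-p3 g3 («needs an LH-restart lemma on 𝕋³»); the restart lemma
`IsGlobalLerayHopf.ae_isGlobalLerayHopf_translate` is in the tree, which unblocks it. Nothing here changes
the verdict of #116 (Step 3 is downstream-irrelevant to the locator (5.18)).

* `nadirashvili2026_step_lerayRate_holds : Literature.Claims.NS.Nadirashvili2026.Step_LerayRate`.

Solo lane (`Theorems/SoloSalvage<Slug>….lean`, no item).

WHAT THIS IS NOT: not a claim about NS regularity or blow-up; not a claim about any author beyond the
typed locator.
-/

noncomputable section

set_option linter.dupNamespace false

open Set MeasureTheory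

namespace Summit.NavierStokesRegularity.NavierStokesRegularity.Theorems.Nadirashvili2026Salvage

open Literature.Analysis.FluidPDE Literature.Analysis.FunctionSpaces Literature.Claims.NS.Nadirashvili2026

/-- **Step 3 `Step_LerayRate` holds** (Theorem 5.6 p. 34 [1482–1487]: at an «époque d'irrégularité» `t₁`
of a Leray–Hopf solution from an `Lᵖ` datum (`p > 3`), `‖∇U(t)‖₂² ≥ C ν^{3/2}/√(t₁ − t)` for all
`t ∈ (0, t₁)` along the classical representative, with an absolute `C > 0`) — by the tree's
`Torus.leray_epoque_rate` applied to the fields `visc`, `lerayHopf`, `classical`, `agrees`, `maximal` of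
`EpoqueData` (the `Lᵖ`/divergence-free clauses of the datum are not needed).
[cite: Nadirashvili2026, Theorem 5.6 p. 34] [cite: RobinsonRodrigoSadowskiCUP2016, Lemma 6.11, §8.1 p. 122] -/
theorem nadirashvili2026_step_lerayRate_holds : Step_LerayRate := by
  obtain ⟨c, hc, H⟩ := Torus.leray_epoque_rate
  refine ⟨c, hc, fun ν p u₀ u t₁ U P E t ht => ?_⟩
  exact H E.visc E.lerayHopf E.classical E.agrees E.maximal t ht

end Summit.NavierStokesRegularity.NavierStokesRegularity.Theorems.Nadirashvili2026Salvage

end
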